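import Literature.ModelTheory.ExponentialFields.RealClosedFieldTheory
import Mathlib.ModelTheory.Algebra.Field.Basic
import Mathlib.ModelTheory.Bundled
import HarnessLib

/-!
# Models of `RCF` are real closed ordered fields

In support of Tarski's theorem (completeness of the theory `Theory.RCF` of real closed fields,
named fact `Literature.ModelTheory.ExponentialFields.tarski_isComplete` of `RealExpField.lean`).
Mathlib's `Theory.IsComplete` quantifies over the *bundled* models
`M : Theory.RCF.ModelType` — bare `Language.orderedRing`-structures satisfying the axioms — while
the real algebra of `Literature/FieldTheory/RealClosedField/` is written for Mathlib fields
`[Field R] [LinearOrder R] [IsStrictOrderedRing R] [IsRealClosed R]`, which are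
`Language.orderedRing`-structures through the global instance
`Language.orderedRing.instStructure` (interpretation by the notation classes, C5). This file
bridges the two: for a bundled model `M` we put on the type synonym `RCFModel.Carrier M` the
structure of a real closed ordered field read off from the interpretation of the symbols, and
show that the identity map is an isomorphism of `Language.orderedRing`-structures between `M`
(with its own structure) and `Carrier M` (with `instStructure`):

* `RCFModel.Carrier M` with instances `Field`, `LinearOrder`, `IsStrictOrderedRing`,
  `IsRealClosed` (the field structure is Mathlib's `FirstOrder.Field.fieldOfModelField` on the
  `Language.ring`-reduct, the order is Mathlib's `Language.linearOrderOfModels`, the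
  compatibilities are the axioms `addMonotoneSentence`, `mulPosSentence`, and real closedness is
  `isRealClosed_of_model_RCF` of C8);
* `RCFModel.carrierEquiv : M ≃[Language.orderedRing] Carrier M` and the transfer
  `RCFModel.realize_sentence_iff : M ⊨ σ ↔ Carrier M ⊨ σ`.

A type synonym is used (rather than instances on `↥M` itself) because notation-class instances
on `↥M` would make `Language.orderedRing.instStructure` a second, non-definitional structure on
`↥M` competing with `M.struc`.

## References

* D. Marker, *Model Theory: An Introduction*, GTM 217 (2002), §1.2 (structures vs. algebras).
* S. Basu, R. Pollack, M.-F. Roy, *Algorithms in Real Algebraic Geometry* (2006), §2.1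
  (definition of real closed field, p. 34).
-/

noncomputable section

open FirstOrder FirstOrder.Language FirstOrder.Language.Structure

universe w

namespace Literature.ModelTheory.ExponentialFields

namespace RCFModel

variable (M : Language.Theory.ModelType.{0, 0, w} Theory.RCF)

/-- The carrier of a bundled model of `RCF`, as a type synonym (it will carry the field
structure read off from the interpretation of the symbols). [folklore] -/
def Carrier : Type w := M

/-! ### Sub-theories of `RCF` satisfied by a model -/

/-- The field axioms (transported to `Language.orderedRing`) are part of `RCF`. [folklore] -/
theorem onTheory_field_subset_RCF :
    ringHomOrderedRing.onTheory Language.Theory.field ⊆ Theory.RCF :=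
  (Set.subset_union_left.trans Set.subset_union_left).trans Theory.orderedField_subset_RCF

/-- The axioms of linear orders are part of `RCF`. [folklore] -/
theorem linearOrderTheory_subset_RCF :
    Language.orderedRing.linearOrderTheory ⊆ Theory.RCF :=
  (Set.subset_union_right.trans Set.subset_union_left).trans Theory.orderedField_subset_RCF

/-- `addMonotoneSentence ∈ RCF`. [folklore] -/
theorem addMonotoneSentence_mem_RCF : addMonotoneSentence ∈ Theory.RCF :=
  Theory.orderedField_subset_RCF (Set.mem_union_right _ (Set.mem_insert _ _))

/-- `mulPosSentence ∈ RCF`. [folklore] -/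
theorem mulPosSentence_mem_RCF : mulPosSentence ∈ Theory.RCF :=
  Theory.orderedField_subset_RCF
    (Set.mem_union_right _ (Set.mem_insert_of_mem _ (Set.mem_singleton _)))

/-! ### The field and the order of a model -/

/-- The `Language.ring`-structure of a model of `RCF`: the reduct along
`ringHomOrderedRing : Language.ring →ᴸ Language.orderedRing`. [folklore] -/
@[reducible] def ringStructure : Language.ring.Structure M := ringHomOrderedRing.reduct M

attribute [local instance] ringStructure

/-- A model of `RCF` is a model of Mathlib's theory of fields (on the `Language.ring`-reduct).
[folklore] -/
theorem model_field : (M : Type w) ⊨ Language.Theory.field :=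
  (LHom.onTheory_model ringHomOrderedRing Language.Theory.field).1
    (Theory.Model.mono M.is_model onTheory_field_subset_RCF)

attribute [local instance] model_field

/-- The field structure of (the carrier of) a model of `RCF`: Mathlib's `fieldOfModelField`, whose
operations are the interpretations of `+, *, -, 0, 1`. [folklore] -/
instance instField : Field (Carrier M) := Field.fieldOfModelField M

/-- A model of `RCF` is a model of the theory of linear orders. [folklore] -/
theorem model_linearOrderTheory : (M : Type w) ⊨ Language.orderedRing.linearOrderTheory :=
  Theory.Model.mono M.is_model linearOrderTheory_subset_RCF

/-- The linear order of (the carrier of) a model of `RCF`: Mathlib's `linearOrderOfModels`, i.e.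
`a ≤ b` iff the symbol `≤` holds of `(a, b)`. [folklore] -/
instance instLinearOrder : LinearOrder (Carrier M) :=
  letI : DecidableRel fun a b : M =>
      RelMap (Language.leSymb : Language.orderedRing.Relations 2) ![a, b] :=
    Classical.decRel _
  haveI := model_linearOrderTheory M
  Language.orderedRing.linearOrderOfModels M

variable {M}

/-- The identity map `M → Carrier M`. [folklore] -/
def toCarrier : M ≃ Carrier M := Equiv.refl _

/-- `a + b` in `Carrier M` is the interpretation of `+` (by definition). [folklore] -/
theorem add_def (a b : M) :
    toCarrier a + toCarrier b = toCarrier (funMap (L := Language.orderedRing) ringFunc.add ![a, b]) :=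
  rfl

/-- `a * b` in `Carrier M` is the interpretation of `*` (by definition). [folklore] -/
theorem mul_def (a b : M) :
    toCarrier a * toCarrier b = toCarrier (funMap (L := Language.orderedRing) ringFunc.mul ![a, b]) :=
  rfl

/-- `-a` in `Carrier M` is the interpretation of `-` (by definition). [folklore] -/
theorem neg_def (a : M) :
    -toCarrier a = toCarrier (funMap (L := Language.orderedRing) ringFunc.neg ![a]) :=
  rfl

/-- `0` in `Carrier M` is the interpretation of `0` (by definition). [folklore] -/
theorem zero_def :
    (0 : Carrier M) = toCarrier (funMap (L := Language.orderedRing)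
      (ringFunc.zero : Language.orderedRing.Functions 0) ![]) :=
  rfl

/-- `1` in `Carrier M` is the interpretation of `1` (by definition). [folklore] -/
theorem one_def :
    (1 : Carrier M) = toCarrier (funMap (L := Language.orderedRing)
      (ringFunc.one : Language.orderedRing.Functions 0) ![]) :=
  rfl

/-- `a ≤ b` in `Carrier M` iff the symbol `≤` holds (by definition). [folklore] -/
theorem le_iff (a b : M) :
    toCarrier a ≤ toCarrier b ↔
      RelMap (L := Language.orderedRing) (M := M) Language.orderRel.le ![a, b] :=
  Iff.rfl

variable (M)

/-- **The identity is an isomorphism of `Language.orderedRing`-structures** between a bundled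
model `M` of `RCF` (with its own interpretation of the symbols) and `Carrier M` (with the
interpretation `Language.orderedRing.instStructure` by the field operations and the order just
defined). [folklore] -/
def carrierEquiv : M ≃[Language.orderedRing] Carrier M where
  toEquiv := toCarrier
  map_fun' := by
    intro n f x
    cases f with
    | add =>
      show toCarrier (funMap (L := Language.orderedRing) ringFunc.add x) =
        toCarrier (x 0) + toCarrier (x 1)
      rw [add_def]
      congr 2
      ext i; fin_cases i <;> rfl
    | mul =>
      show toCarrier (funMap (L := Language.orderedRing) ringFunc.mul x) =
        toCarrier (x 0) * toCarrier (x 1)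
      rw [mul_def]
      congr 2
      ext i; fin_cases i <;> rfl
    | neg =>
      show toCarrier (funMap (L := Language.orderedRing) ringFunc.neg x) = -toCarrier (x 0)
      rw [neg_def]
      congr 2
      ext i; fin_cases i; rfl
    | zero =>
      show toCarrier (funMap (L := Language.orderedRing) ringFunc.zero x) = (0 : Carrier M)
      rw [zero_def]
      congr 2
      exact Subsingleton.elim _ _
    | one =>
      show toCarrier (funMap (L := Language.orderedRing) ringFunc.one x) = (1 : Carrier M)
      rw [one_def]
      congr 2
      exact Subsingleton.elim _ _
  map_rel' := by
    intro n r x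
    cases r
    show toCarrier (x 0) ≤ toCarrier (x 1) ↔ RelMap (L := Language.orderedRing) Language.orderRel.le x
    rw [le_iff]
    have hx : ![x 0, x 1] = x := by ext i; fin_cases i <;> rfl
    rw [hx]

/-- **Transfer along the identity**: a sentence holds in the bundled model `M` iff it holds in the
ordered field `Carrier M`. [folklore] -/
theorem realize_sentence_iff (σ : Language.orderedRing.Sentence) : M ⊨ σ ↔ Carrier M ⊨ σ :=
  StrongHomClass.realize_sentence (carrierEquiv M) σ

/-- `Carrier M` is a model of `RCF`. [folklore] -/
instance model_RCF : Carrier M ⊨ Theory.RCF :=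
  StrongHomClass.theory_model (T := Theory.RCF) (carrierEquiv M)

/-! ### Ordered field and real closedness -/

/-- Addition is monotone in `Carrier M` (axiom `addMonotoneSentence`). [folklore] -/
theorem add_le_add_left' (a b : Carrier M) (h : a ≤ b) (c : Carrier M) : c + a ≤ c + b := by
  have hs : Carrier M ⊨ addMonotoneSentence :=
    Language.Theory.realize_sentence_of_mem Theory.RCF addMonotoneSentence_mem_RCF
  rw [realize_addMonotoneSentence] at hs
  exact hs a b c h

/-- Products of nonnegative elements are nonnegative in `Carrier M` (axiom `mulPosSentence`).
[folklore] -/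
theorem mul_nonneg' (a b : Carrier M) (ha : 0 ≤ a) (hb : 0 ≤ b) : 0 ≤ a * b := by
  have hs : Carrier M ⊨ mulPosSentence :=
    Language.Theory.realize_sentence_of_mem Theory.RCF mulPosSentence_mem_RCF
  rw [realize_mulPosSentence] at hs
  exact hs a b ha hb

/-- `Carrier M` is an ordered additive group. [folklore] -/
instance : IsOrderedAddMonoid (Carrier M) where
  add_le_add_left a b hab c := by
    rw [add_comm a, add_comm b]
    exact add_le_add_left' M a b hab c

/-- `0 ≤ 1` in `Carrier M`. [folklore] -/
theorem zero_le_one' : (0 : Carrier M) ≤ 1 := by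
  rcases le_total (0 : Carrier M) 1 with h | h
  · exact h
  · have h1 : (0 : Carrier M) ≤ -1 := by
      have := add_le_add_left' M 1 0 h (-1)
      rwa [neg_add_cancel, add_zero] at this
    have := mul_nonneg' M (-1) (-1) h1 h1
    rwa [neg_mul_neg, one_mul] at this

/-- **A model of `RCF` is a (strictly) ordered field.** [folklore] -/
instance : IsStrictOrderedRing (Carrier M) :=
  haveI : ZeroLEOneClass (Carrier M) := ⟨zero_le_one' M⟩
  IsStrictOrderedRing.of_mul_pos fun a b ha hb =>
    lt_of_le_of_ne (mul_nonneg' M a b ha.le hb.le) (mul_ne_zero ha.ne' hb.ne').symm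

/-- **A model of `RCF` is a real closed field** in Mathlib's sense (`isRealClosed_of_model_RCF`,
C8: nonnegative elements are squares and odd-degree polynomials have roots).
[cite: BasuPollackRoy2006, §2.1 (p. 34, definition of real closed field)] -/
instance isRealClosed : IsRealClosed (Carrier M) := by
  letI := Ring.compatibleRingOfRing (Carrier M)
  exact isRealClosed_of_model_RCF (Carrier M)

end RCFModel

end Literature.ModelTheory.ExponentialFields
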